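import Literature.NumberTheory.Weil1964.ArchMetaplecticUnitaryDetCharacter
import Literature.NumberTheory.Weil1964.ArchMetaplecticSplittingsHolds
import HarnessLib

/-!
# The metaplectic `S¹`-extension SPLITS over `U(α, β)` at every real rank: the `det^{1/2}`-normalised section is a
# homomorphism `U(α, β) →* Mp^𝓢(W)` (the archimedean Weil representation of the pair `(U(α,β), U(1))`, kernel)

Topic `NumberTheory/Weil1964`; namespace `Literature.NumberTheory.Weil1964.UnitaryWeil`.  KERNEL ONLY: two
definitions with bodies (`weilElt`, `weilHom`) and theorems; no record, no `Prop`-valued definition, no hypothesis,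
no `sorry`.

THE RESULT.  Let `W = ℝ^{α⊕β} × ℝ^{α⊕β}` with the dot pairing, `toSp : U(α, β) →* Sp(W)` the tree's standard
embedding (`KonnoKonno2007.RealDualPair.UForm.toSp`, the pair `(U(α,β), U(1))` in Fock-adapted real coordinates),
`Mp^𝓢(W) = MpS (α ⊕ β)` the group of Heisenberg-covariant topological automorphisms of `𝓢(ℝ^{α⊕β})` with unitary
`L²`-lifts (an `S¹`-extension of `Sp(W)`, `ArchMetaplecticExtension`), and `θ(x) = C(x) · det d(G)` the `det^{1/2}`
character of `ArchMetaplecticUnitaryDetCharacter` on Folland-metaplectic elements `x` over `toSp G`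
(`detHalf_sq : θ² = det G`, `detHalf_mul`, `norm_detHalf`).  Then

* §1 `weilElt G := θ(x)⁻¹ · x` (for a metaplectic `x` over `toSp G`, which exists by Folland's Theorem (4.37)(a)(b),
  `folland1989_Thm_4_37_ab_holds`) does not depend on `x` (`weilElt_eq`), lies over `toSp G` (`proj_weilElt`) and has
  vacuum coefficient `C(weilElt G) = (det d(G))⁻¹` (`vac_weilElt`); it is THE element of `Mp^𝓢(W)` over `toSp G` with
  that vacuum coefficient (`eq_weilElt`);
* §2 **`weilHom : U(α, β) →* Mp^𝓢(W)`, `G ↦ weilElt G`, is a HOMOMORPHISM** (`θ(xy) = θ(x)θ(y)` and (4.37)(c),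
  `folland1989_Thm_4_37_c_holds`): a continuous-operator-valued splitting of the metaplectic `S¹`-extension over
  `toSp(U(α,β))` — i.e. the Weil representation of `U(α,β)` attached to the pair `(U(α,β), U(1))` EXISTS as a genuine
  representation by implementers, at EVERY signature `(|α|, |β|)` and every real rank, with no cited input
  [Kudla1994, Prop. 4.1 / §5 (real case); Paul1998, §1.2 (1.2.1)–(1.2.2); KashiwaraVergne1978, §3];
* §3 the operator form: `weilOp G : 𝓢 →L[ℂ] 𝓢`, multiplicative, Heisenberg-covariant over `toSp G`
  (`weilOp_rhoS`), with unitary `L²`-lifts, each `weilOp G` a scalar multiple of ANY implementer of `toSp G`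
  with the scalar read off at the vacuum (`weilOp_eq_smul_of_isImplementerS`), and the values on the maximal compact
  `K = U(α) × U(β)`: `C(weilElt (kV k)) = (det k₂)⁻¹` (`vac_weilHom_kV`).

Continuity (w1) of `G ↦ weilOp G f` is NOT in this file (sequel, via the `KAK` decomposition of `RealUnitaryKAK`).

## References

* [Kudla1994] S. S. Kudla, *Splitting metaplectic covers of dual reductive pairs*, Israel J. Math. 87 (1994) 361–401,
  Prop. 4.1, §5.
* [Paul1998] A. Paul, *Howe correspondence for real unitary groups*, J. Funct. Anal. 159 (1998), §1.2 (1.2.1)–(1.2.2).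
* [KashiwaraVergne1978] M. Kashiwara, M. Vergne, Invent. Math. 44 (1978), §3.
* [Folland1989] G. B. Folland, *Harmonic Analysis in Phase Space*, Princeton UP 1989, §4.2 Thm. (4.37), Prop. (4.39).
-/

set_option autoImplicit false

noncomputable section

open Matrix Complex MeasureTheory SchwartzMap
open scoped ComplexConjugate

namespace Literature.NumberTheory.Weil1964

open Literature.RepresentationTheory.KonnoKonno2007 Literature.RepresentationTheory.KonnoKonno2007.RealDualPair
open Literature.NumberTheory.Automorphic Literature.NumberTheory.Automorphic.UnitaryGroup
open Literature.Analysis.SegalBargmann Literature.RepresentationTheory.HeisenbergGroup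
open MpS UnitaryBall

namespace UnitaryWeil

variable {α β : Type*} [Fintype α] [DecidableEq α] [Fintype β] [DecidableEq β]

local notation "SR" σ => SchwartzMap (σ → ℝ) ℂ

/-! ## 0. Two fibre lemmas for `Mp^𝓢(W)` -/

/-- Two elements of `Mp^𝓢(W)` over the same symplectic element with the same NON-ZERO vacuum coefficient are equal
(Schur: they differ by a unimodular scalar, read off at the vacuum). [cite: Folland1989, §4.2 (4.23), the Schur remark p. 156] -/
theorem _root_.Literature.NumberTheory.Weil1964.MpS.eq_of_proj_eq_of_vac_eq {σ : Type*} [Fintype σ] [DecidableEq σ]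
    {x y : MpS σ} (hp : proj x = proj y) (hv : vac x = vac y) (hx : vac x ≠ 0) : x = y := by
  obtain ⟨c, hc, hcx⟩ := exists_eq_unitScalar_mul_of_proj_eq hp
  have h1 : vac y = c * vac x := by rw [hcx, vac_unitScalar_mul]
  rw [← hv] at h1
  have hc1 : c = 1 := by
    have h2 : (c - 1) * vac x = 0 := by linear_combination -h1
    have h3 := (mul_eq_zero.1 h2).resolve_right hx
    linear_combination h3
  subst hc1
  rw [hcx, unitScalar_one, one_mul]

/-- `θ(x) ≠ 0` for a metaplectic `x` over `toSp G`. [cite: Paul1998, §1.2 (1.2.2)] -/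
theorem detHalf_ne_zero' {x : MpS (α ⊕ β)} (hx : IsMetaplectic x) {G : UForm α β}
    (hxG : proj x = UForm.toSp α β G) : detHalf x G ≠ 0 := fun h => by
  have h1 := norm_detHalf hx hxG
  rw [h, norm_zero] at h1
  exact zero_ne_one h1

/-- `‖θ(x)⁻¹‖ = 1`. [cite: Paul1998, §1.2 (1.2.2)] -/
theorem norm_detHalf_inv {x : MpS (α ⊕ β)} (hx : IsMetaplectic x) {G : UForm α β}
    (hxG : proj x = UForm.toSp α β G) : ‖(detHalf x G)⁻¹‖ = 1 := by
  rw [norm_inv, norm_detHalf hx hxG, inv_one]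

/-! ## 1. The `det^{1/2}`-normalised element over `toSp G` -/

/-- A Folland-metaplectic element over `toSp G` (choice; Theorem (4.37)(a)(b)). [cite: Folland1989, §4.2 Thm. (4.37)] -/
def metElt (G : UForm α β) : MpS (α ⊕ β) :=
  Classical.choose (folland1989_Thm_4_37_ab_holds (α ⊕ β) (UForm.toSp α β G))

/-- `metElt G` lies over `toSp G`. [cite: Folland1989, §4.2 Thm. (4.37)] -/
theorem proj_metElt (G : UForm α β) : proj (metElt G) = UForm.toSp α β G :=
  (Classical.choose_spec (folland1989_Thm_4_37_ab_holds (α ⊕ β) (UForm.toSp α β G))).1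

/-- `metElt G` is metaplectic. [cite: Folland1989, §4.2 Thm. (4.37)] -/
theorem isMetaplectic_metElt (G : UForm α β) : IsMetaplectic (metElt G) :=
  (Classical.choose_spec (folland1989_Thm_4_37_ab_holds (α ⊕ β) (UForm.toSp α β G))).2

/-- **The `det^{1/2}`-normalised element** `weilElt G = θ(x)⁻¹ · x ∈ Mp^𝓢(W)` over `toSp G` (`x` metaplectic over
`toSp G`; independent of `x`, `weilElt_eq`). [cite: Kudla1994, Prop. 4.1; Paul1998, §1.2 (1.2.1)–(1.2.2)] -/
def weilElt (G : UForm α β) : MpS (α ⊕ β) :=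
  unitScalar (detHalf (metElt G) G)⁻¹ (norm_detHalf_inv (isMetaplectic_metElt G) (proj_metElt G)) * metElt G

/-- `weilElt G` lies over `toSp G`. [cite: Kudla1994, Prop. 4.1] -/
@[simp] theorem proj_weilElt (G : UForm α β) : proj (weilElt G) = UForm.toSp α β G := by
  rw [weilElt, map_mul, proj_unitScalar, one_mul, proj_metElt]

/-- For ANY metaplectic `x` over `toSp G`: `C(θ(x)⁻¹ · x) = (det d(G))⁻¹`. [cite: Paul1998, §1.2 (1.2.2)] -/
theorem vac_unitScalar_detHalf_inv_mul {x : MpS (α ⊕ β)} (hx : IsMetaplectic x) {G : UForm α β}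
    (hxG : proj x = UForm.toSp α β G) :
    vac (unitScalar (detHalf x G)⁻¹ (norm_detHalf_inv hx hxG) * x) = ((d G).det)⁻¹ := by
  rw [vac_unitScalar_mul, detHalf, mul_inv, mul_comm (vac x)⁻¹, mul_assoc, inv_mul_cancel₀ hx.vac_ne_zero, mul_one]

/-- **The vacuum coefficient of `weilElt G` is `(det d(G))⁻¹`** (`d(G)` the `β`-block of `G`).
[cite: Paul1998, §1.2 (1.2.2); Folland1989, Prop. (4.39)] -/
@[simp] theorem vac_weilElt (G : UForm α β) : vac (weilElt G) = ((d G).det)⁻¹ :=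
  vac_unitScalar_detHalf_inv_mul (isMetaplectic_metElt G) (proj_metElt G)

/-- `C(weilElt G) ≠ 0`. [cite: Folland1989, §4.2 (4.36)] -/
theorem vac_weilElt_ne_zero (G : UForm α β) : vac (weilElt G) ≠ 0 := by
  rw [vac_weilElt]
  exact inv_ne_zero (det_d_ne_zero G)

/-- **Characterisation**: the element of `Mp^𝓢(W)` over `toSp G` with vacuum coefficient `(det d(G))⁻¹` is `weilElt G`.
[cite: Folland1989, §4.2, the Schur remark p. 156] -/
theorem eq_weilElt {y : MpS (α ⊕ β)} {G : UForm α β} (hyG : proj y = UForm.toSp α β G)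
    (hv : vac y = ((d G).det)⁻¹) : y = weilElt G :=
  MpS.eq_of_proj_eq_of_vac_eq (by rw [hyG, proj_weilElt]) (by rw [hv, vac_weilElt])
    (by rw [hv]; exact inv_ne_zero (det_d_ne_zero G))

/-- **Independence of the metaplectic representative**: `weilElt G = θ(x)⁻¹ · x` for EVERY metaplectic `x` over `toSp G`.
[cite: Paul1998, §1.2 (1.2.2)] -/
theorem weilElt_eq {x : MpS (α ⊕ β)} (hx : IsMetaplectic x) {G : UForm α β} (hxG : proj x = UForm.toSp α β G) :
    weilElt G = unitScalar (detHalf x G)⁻¹ (norm_detHalf_inv hx hxG) * x :=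
  (eq_weilElt (by rw [map_mul, proj_unitScalar, one_mul, hxG]) (vac_unitScalar_detHalf_inv_mul hx hxG)).symm

/-! ## 2. The homomorphism -/

/-- **`weilElt` is multiplicative**: `θ(xy) = θ(x)θ(y)` for metaplectic `x, y` over `toSp G, toSp G′` and `xy` is
metaplectic over `toSp (GG′)` (Folland (4.37)(c)). [cite: Kudla1994, Prop. 4.1; Paul1998, §1.2 (1.2.1)–(1.2.2)] -/
theorem weilElt_mul (G G' : UForm α β) : weilElt (G * G') = weilElt G * weilElt G' := by
  have hx := isMetaplectic_metElt G
  have hy := isMetaplectic_metElt G'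
  have hxG := proj_metElt G
  have hyG := proj_metElt G'
  have hxy : IsMetaplectic (metElt G * metElt G') := folland1989_Thm_4_37_c_holds (α ⊕ β) _ _ hx hy
  have hxyG : proj (metElt G * metElt G') = UForm.toSp α β (G * G') := by rw [map_mul, hxG, hyG, map_mul]
  rw [weilElt_eq hxy hxyG]
  have hθ : (detHalf (metElt G * metElt G') (G * G'))⁻¹ = (detHalf (metElt G) G)⁻¹ * (detHalf (metElt G') G')⁻¹ := by
    rw [detHalf_mul hx hy hxG hyG, mul_inv]
  have h1 : (unitScalar (detHalf (metElt G * metElt G') (G * G'))⁻¹ (norm_detHalf_inv hxy hxyG) : MpS (α ⊕ β)) =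
      unitScalar (detHalf (metElt G) G)⁻¹ (norm_detHalf_inv hx hxG) *
        unitScalar (detHalf (metElt G') G')⁻¹ (norm_detHalf_inv hy hyG) := by
    rw [unitScalar_mul_unitScalar]
    exact ext' rfl fun f => by rw [unitScalar_apply, unitScalar_apply, hθ]
  rw [h1, weilElt, weilElt, mul_assoc, mul_assoc, ← mul_assoc (metElt G),
    ← unitScalar_mul_comm _ _ (metElt G), mul_assoc]

/-- **THE SPLITTING `U(α, β) →* Mp^𝓢(W)`** over `toSp` — the archimedean Weil representation of `U(α, β)` for the
pair `(U(α,β), U(1))`, as a homomorphism into the implementer group, at every real rank; no hypothesis.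
[cite: Kudla1994, Prop. 4.1, §5; Paul1998, §1.2 (1.2.1)–(1.2.2); KashiwaraVergne1978, §3] -/
def weilHom : UForm α β →* MpS (α ⊕ β) :=
  MonoidHom.mk' weilElt weilElt_mul

/-- `weilElt 1 = 1`. [cite: Kudla1994, Prop. 4.1] -/
@[simp] theorem weilElt_one : weilElt (1 : UForm α β) = 1 :=
  (weilHom (α := α) (β := β)).map_one

/-- Unfolding. [cite: Kudla1994, Prop. 4.1] -/
@[simp] theorem weilHom_apply (G : UForm α β) : weilHom G = weilElt G := rfl

/-- `proj ∘ weilHom = toSp`. [cite: Kudla1994, Prop. 4.1] -/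
theorem proj_comp_weilHom : proj.comp (weilHom (α := α) (β := β)) = UForm.toSp α β :=
  MonoidHom.ext fun G => proj_weilElt G

/-! ## 3. The operator form: a genuine representation on `𝓢(ℝ^{α⊕β})`, covariant over `toSp`, with unitary lifts -/

/-- The operator `S` of `x = (g, S) ∈ Mp^𝓢(W)` as a linear endomorphism of `𝓢(ℝ^σ)`; a homomorphism
`Mp^𝓢(W) →* End 𝓢(ℝ^σ)`. [cite: Folland1989, §4.2 (4.23)] -/
def _root_.Literature.NumberTheory.Weil1964.MpS.toEnd {σ : Type*} [Fintype σ] [DecidableEq σ] :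
    MpS σ →* Module.End ℂ (SR σ) where
  toFun x := ((x.1.2 : (SR σ) ≃L[ℂ] SR σ) : (SR σ) →L[ℂ] SR σ)
  map_one' := rfl
  map_mul' _ _ := rfl

/-- `toEnd x f = S f`. [cite: Folland1989, §4.2 (4.23)] -/
@[simp] theorem _root_.Literature.NumberTheory.Weil1964.MpS.toEnd_apply {σ : Type*} [Fintype σ] [DecidableEq σ]
    (x : MpS σ) (f : SR σ) : MpS.toEnd x f = x.1.2 f := rfl

/-- **The Weil representation of `U(α, β)` on `𝓢(ℝ^{α⊕β})`** (pair `(U(α,β), U(1))`), `G ↦` the operator of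
`weilElt G`. [cite: Kudla1994, Prop. 4.1, §5; KashiwaraVergne1978, §3] -/
def weilRep : Representation ℂ (UForm α β) (SR (α ⊕ β)) := MpS.toEnd.comp weilHom

/-- `weilRep G f = (weilElt G) f`. [cite: Kudla1994, Prop. 4.1] -/
@[simp] theorem weilRep_apply (G : UForm α β) (f : SR (α ⊕ β)) : weilRep G f = (weilElt G).1.2 f := rfl

/-- **(w2) Heisenberg covariance over `toSp`**: `ω(G) ρ(p,q) = ρ(toSp(G)(p,q)) ω(G)`. [cite: Folland1989, §4.2 (4.23)] -/
theorem isPhaseCovariantS_weilRep :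
    IsPhaseCovariantS
      (fun G : UForm α β => ⇑((UForm.toSp α β G).1 :
        ((α ⊕ β → ℝ) × (α ⊕ β → ℝ)) ≃ₗ[ℝ] ((α ⊕ β → ℝ) × (α ⊕ β → ℝ))))
      (fun G => weilRep G) := fun G p q f => by
  have h := ((MpS.mem_iff_covariant _).1 (weilElt G).2).1 p q f
  have hp : (weilElt G).1.1 = UForm.toSp α β G := proj_weilElt G
  rw [hp] at h
  exact h

/-- **(w2′) unitary lifts**: every `ω(G)` is the restriction of a unitary operator of `L²(ℝ^{α⊕β})`.
[cite: Folland1989, §4.2 Prop. (4.27)] -/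
theorem exists_lift_weilRep (G : UForm α β) :
    ∃ U : Lp ℂ 2 (volume : Measure (α ⊕ β → ℝ)) ≃ₗᵢ[ℂ] Lp ℂ 2 (volume : Measure (α ⊕ β → ℝ)),
      LiftsTo (weilRep G) ((U.toContinuousLinearEquiv :
        Lp ℂ 2 (volume : Measure (α ⊕ β → ℝ)) ≃L[ℂ] Lp ℂ 2 (volume : Measure (α ⊕ β → ℝ))) :
          Lp ℂ 2 (volume : Measure (α ⊕ β → ℝ)) →L[ℂ] Lp ℂ 2 (volume : Measure (α ⊕ β → ℝ))) :=
  ((MpS.mem_iff_covariant _).1 (weilElt G).2).2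

/-- **Folland's quotient character on the splitting**: `C(weilElt G)² · det P(toSp G) = (det G)⁻¹` — the
`det^{1/2}`-normalised element is metaplectic exactly up to the square root of `det G`.
[cite: Folland1989, §4.2 (4.36)–(4.37); Paul1998, §1.2 (1.2.2)] -/
theorem vac_sq_mul_det_follandP_weilElt (G : UForm α β) :
    vac (weilElt G) ^ 2 * (Sp.follandP (UForm.toSp α β G)).det = ((mat G).det)⁻¹ := by
  have hx := isMetaplectic_metElt G
  have hxG := proj_metElt G
  have hmet : vac (metElt G) ^ 2 * (Sp.follandP (UForm.toSp α β G)).det = 1 := by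
    rw [← hxG]; exact hx
  have hθ2 := detHalf_sq hx hxG
  rw [weilElt, vac_unitScalar_mul, mul_pow, mul_assoc, hmet, mul_one, inv_pow, hθ2]

/-- `G ↦ C(weilElt G) = (det d(G))⁻¹` is continuous on `U(α, β)`. [cite: Folland1989, §4.2 (4.36)] -/
theorem continuous_vac_weilElt : Continuous fun G : UForm α β => vac (weilElt G) := by
  simp only [vac_weilElt]
  have hd : Continuous fun G : UForm α β => d G := by
    show Continuous fun G : UForm α β => (mat G).submatrix Sum.inr Sum.inr
    exact (Units.continuous_val.comp continuous_subtype_val).matrix_submatrix _ _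
  exact (Continuous.matrix_det hd).inv₀ fun G => det_d_ne_zero G

/-! ## 4. The first factor of a real unitary dual pair `(U(P,Q), U(R,S))` -/

section Junction

variable {P Q R S : Type*} [Fintype P] [DecidableEq P] [Fintype Q] [DecidableEq Q] [Fintype R] [DecidableEq R]
  [Fintype S] [DecidableEq S]

variable (P Q R S) in
/-- **The Weil representation of the first member `U(P,Q)` of the real dual pair `(U(P,Q), U(R,S))`** as a
homomorphism `U(P,Q) →* Mp^𝓢(𝕎)`, `𝕎 = V ⊗ W` in the tree's block coordinates `DPIdx P Q R S`: the splitting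
`weilHom` of the big group `U((P×R) ⊕ (Q×S), (P×S) ⊕ (Q×R))` restricted along `g ↦ g ⊗ 1_W` (`toBig (g, 1)`).
[cite: Kudla1994, §5; Paul1998, §1.2 (1.2.1); KonnoKonno2007, §3.3] -/
def weilHomV : UForm P Q →* MpS (DPIdx P Q R S) :=
  (weilHom (α := (P × R) ⊕ (Q × S)) (β := (P × S) ⊕ (Q × R))).comp
    ((toBig P Q R S).comp (MonoidHom.inl (UForm P Q) (UForm R S)))

/-- Unfolding. [cite: KonnoKonno2007, §3.3] -/
theorem weilHomV_apply (g : UForm P Q) : weilHomV P Q R S g = weilElt (toBig P Q R S (g, 1)) := rfl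

/-- `weilHomV g` lies over `ι𝕎 (g, 1)` (`ι𝕎 = toSp ∘ toBig` by construction). [cite: KonnoKonno2007, §3.1 (3.1)] -/
@[simp] theorem proj_weilHomV (g : UForm P Q) : proj (weilHomV P Q R S g) = ι𝕎 P Q R S (g, 1) := by
  rw [weilHomV_apply, proj_weilElt]
  rfl

/-- its vacuum coefficient: `(det d(g ⊗ 1_W))⁻¹`, non-zero. [cite: Folland1989, Prop. (4.39)] -/
theorem vac_weilHomV (g : UForm P Q) : vac (weilHomV P Q R S g) = ((d (toBig P Q R S (g, 1))).det)⁻¹ := by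
  rw [weilHomV_apply, vac_weilElt]

/-- `C(weilHomV g) ≠ 0`. [cite: Folland1989, §4.2 (4.36)] -/
theorem vac_weilHomV_ne_zero (g : UForm P Q) : vac (weilHomV P Q R S g) ≠ 0 := by
  rw [weilHomV_apply]; exact vac_weilElt_ne_zero _

/-- `MulEquiv.subgroupCongr` (equal subgroups) is continuous. [folklore] -/
private theorem continuous_subgroupCongr' {G : Type*} [Group G] [TopologicalSpace G] {H K : Subgroup G}
    (h : H = K) : Continuous (MulEquiv.subgroupCongr h) := by
  subst h
  exact continuous_id

/-- `toBig` is continuous. [cite: KonnoKonno2007, §3.1 (3.1)] -/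
theorem continuous_toBig : Continuous (toBig P Q R S) := by
  unfold toBig
  simp only [MonoidHom.coe_comp, MulEquiv.coe_toMonoidHom]
  exact (continuous_subgroupCongr' _).comp ((continuous_reindexU _ _ _).comp (continuous_dualPair _ _ _))

/-- `g ↦ C(weilHomV g)` is continuous. [cite: Folland1989, §4.2 (4.36)] -/
theorem continuous_vac_weilHomV : Continuous fun g : UForm P Q => vac (weilHomV P Q R S g) := by
  have h : (fun g : UForm P Q => vac (weilHomV P Q R S g)) =
      (fun G => vac (weilElt G)) ∘ fun g : UForm P Q => toBig P Q R S (g, 1) := rfl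
  rw [h]
  exact continuous_vac_weilElt.comp (continuous_toBig.comp (continuous_id.prodMk continuous_const))

variable (P Q R S) in
/-- **The Weil representation of `U(P,Q)` on `𝓢(ℝ^{DPIdx})`** (operator form of `weilHomV`).
[cite: Kudla1994, §5; KonnoKonno2007, §3.3] -/
def weilRepV : Representation ℂ (UForm P Q) (SR (DPIdx P Q R S)) := MpS.toEnd.comp (weilHomV P Q R S)

/-- `weilRepV g f = (weilHomV g) f`. [cite: KonnoKonno2007, §3.3] -/
@[simp] theorem weilRepV_apply (g : UForm P Q) (f : SR (DPIdx P Q R S)) :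
    weilRepV P Q R S g f = (weilHomV P Q R S g).1.2 f := rfl

/-- (w2) covariance of `weilRepV` over `g ↦ ι𝕎 (g, 1)`. [cite: Folland1989, §4.2 (4.23); KonnoKonno2007, §3.1] -/
theorem isPhaseCovariantS_weilRepV :
    IsPhaseCovariantS
      (fun g : UForm P Q => ⇑((ι𝕎 P Q R S (g, 1)).1 :
        ((DPIdx P Q R S → ℝ) × (DPIdx P Q R S → ℝ)) ≃ₗ[ℝ] ((DPIdx P Q R S → ℝ) × (DPIdx P Q R S → ℝ))))
      (fun g => weilRepV P Q R S g) := fun g p q f => by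
  have h := ((MpS.mem_iff_covariant _).1 (weilHomV P Q R S g).2).1 p q f
  have hp : (weilHomV P Q R S g).1.1 = ι𝕎 P Q R S (g, 1) := proj_weilHomV g
  rw [hp] at h
  exact h

/-- (w2′) unitary lifts of `weilRepV`. [cite: Folland1989, §4.2 Prop. (4.27)] -/
theorem exists_lift_weilRepV (g : UForm P Q) :
    ∃ U : Lp ℂ 2 (volume : Measure (DPIdx P Q R S → ℝ)) ≃ₗᵢ[ℂ] Lp ℂ 2 (volume : Measure (DPIdx P Q R S → ℝ)),
      LiftsTo (weilRepV P Q R S g) ((U.toContinuousLinearEquiv :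
        Lp ℂ 2 (volume : Measure (DPIdx P Q R S → ℝ)) ≃L[ℂ] Lp ℂ 2 (volume : Measure (DPIdx P Q R S → ℝ))) :
          Lp ℂ 2 (volume : Measure (DPIdx P Q R S → ℝ)) →L[ℂ] Lp ℂ 2 (volume : Measure (DPIdx P Q R S → ℝ))) :=
  ((MpS.mem_iff_covariant _).1 (weilHomV P Q R S g).2).2

end Junction

end UnitaryWeil

end Literature.NumberTheory.Weil1964
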